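import Literature.AnabelianGeometry.EtaleTheta.BiKummerThm44SubModelConnected
import Literature.AnabelianGeometry.EtaleTheta.BiKummerThm44SubNHSatRootsReading

/-!
# [EtTh] Theorem 4.4 (i) ∧ (ii) ∧ (iii) ∧ (N-th roots) at the GENUINE connected base AT THE ROOTS READING of the
# `(N, H_⊙^{bs-fld})`-saturation slot — the last named input T44-L15b discharged

S. Mochizuki, *The étale theta function and its Frobenioid-theoretic manifestations*, Publ. RIMS **45** (2009)
[MochizukiEtTh2009], §4, Thm 4.4 (i)–(iii) PDF p.94, proof p.95.  abc-iut cell, layer L2, plan/L2/SUBDAG-EtTh-Thm44.md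
(custodian abc-iut-w5-d179) v7.3: `Thm44Hyp.thm44_mkOfConnectedTemperoid` (p431376) assembles Thm 4.4 (i) ∧ (ii) ∧
(iii)-saturation ∧ T44-L14 at abc-iut-L2-t4's genuine connected base `mkOfConnectedTemperoid` (`B^temp(Π^tp_X)⁰`,
`Discharge/Sec5OfConnectedTemperoid.lean`) ⇐ {Rmk 3.7.2 (`Remark372 D₀ / D₀'`), `hBmon₁ / hBmon₂`, **T44-L15b**
(`PreservesNHSaturatedBsFld` over the FREE `(N,H)`-saturation slot)}.  Seat abc-iut-w4-d044 (gen 3).  PROOF-ONLY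
(0 `def`s): one composition; nothing landed is edited or restated.

`mkOfConnectedTemperoid X tf hZ hP NH A₀ …` IS `mkOfModelCanonical` at the connected temperoid base with `NH` free
(definitionally).  Instantiating BOTH `NH_i` by the ROOTS READING (HONEST LABEL: «`Div_B`-trivial elements of
`B_i(A_{⊙,i}^bs)` acquire `N`-th roots in `B_i(A^bs)` along every `A^bs ⟶ A_{⊙,i}^bs`», the consequence [FrdII]
Rmk 2.2.1 draws from Def 2.2 (ii)(c) — WEAKER than print's cohomological definition; see
`BiKummerThm44SubNHSatRootsReading.lean`, p431503, and `Discharge/Sec4Prop42SubRootsReading.lean`, p428987), the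
binder T44-L15b is the THEOREM `Thm44Hyp.preservesNHSaturatedBsFld_rootsReading`, whence

* `Thm44Hyp.thm44_mkOfConnectedTemperoid_rootsReading` — **[EtTh] Thm 4.4 (i) ∧ (ii) ∧ (iii)-saturation ∧
  (`N`-th roots) at the genuine connected base AT THE ROOTS READING ⇐ {`Remark372 D₀ / D₀'`, `hBmon₁ / hBmon₂`}
  ONLY** — the [SemiAnbd] Ex 3.10 / [FrdII] Ex 1.3 (i) named fact and the Def 3.6 (ii) datum «`B` is a monoid on
  `D`»; no row of the sub-DAG is a binder any more at that reading.

At the faithful [FrdII] Def 2.2 (ii) reading T44-L15b remains the [FrdII]/[AbsAnab] Lem 1.3.8 input (abc-iut-L1-t4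
/ L4); the Kummer-class clause of (iii) (T44-L16) is not included (as in p431376).  HONEST FRAMING: refereed pre-IUT
material; a reading of a free interface slot, labelled in the theorem name; nothing here asserts that such data
exist for an actual curve or bears on the disputed [IUTchIII] Cor. 3.12; typed ≠ proved — here PROVED.
-/

noncomputable section

namespace Literature.AnabelianGeometry.EtaleTheta

open CategoryTheory Opposite Literature.AlgebraicGeometry.Frobenioids Literature.AnabelianGeometry.SemiGraphs

namespace BiKummerSetting

universe u₀ v₀ u v w

section Connected

variable {K : Type u₀} [Field K] {K' : Type u₀} [Field K'] {X₁ : SemiGraphs.TemperedArithmeticGroup.{u₀} K}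
  {X₂ : SemiGraphs.TemperedArithmeticGroup.{u₀} K'} {D₀ : Type u₀} [Category.{v₀} D₀] {D₀' : Type u₀}
  [Category.{v₀} D₀'] {T₁ : RealifiedDivisorMonoids (D₀ := D₀) treeMonoidVocab.{w}}
  {T₂ : RealifiedDivisorMonoids (D₀ := D₀') treeMonoidVocab.{w}}
  {IsRational₁ IsStrictlyRational₁ : ((ConnectedPart (BTemp X₁.Pi))ᵒᵖ ⥤ CommMonCat.{w}) → Prop}
  {IsRational₂ IsStrictlyRational₂ : ((ConnectedPart (BTemp X₂.Pi))ᵒᵖ ⥤ CommMonCat.{w}) → Prop}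
  (tf₁ : TemperedFrobenioid T₁ (ConnectedPart (BTemp X₁.Pi))
    (treeCatVocab (ConnectedPart (BTemp X₁.Pi)) IsRational₁ IsStrictlyRational₁))
  (hZ₁ : tf₁.monoidType = MonoidType.Z) (hP₁ : ∀ A : (ConnectedPart (BTemp X₁.Pi))ᵒᵖ, IsPerfect (tf₁.Φ.carrier A))
  (A₁ : tf₁.category) (hA₁ : PreFrobenioid.IsFrobeniusTrivial tf₁.toElem A₁)
  (hA₁' : SemiGraphs.IsGaloisObj A₁.base.obj)
  (tf₂ : TemperedFrobenioid T₂ (ConnectedPart (BTemp X₂.Pi))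
    (treeCatVocab (ConnectedPart (BTemp X₂.Pi)) IsRational₂ IsStrictlyRational₂))
  (hZ₂ : tf₂.monoidType = MonoidType.Z) (hP₂ : ∀ B : (ConnectedPart (BTemp X₂.Pi))ᵒᵖ, IsPerfect (tf₂.Φ.carrier B))
  (A₂ : tf₂.category) (hA₂ : PreFrobenioid.IsFrobeniusTrivial tf₂.toElem A₂)
  (hA₂' : SemiGraphs.IsGaloisObj A₂.base.obj)

/-- **[EtTh] Thm 4.4 (i) ∧ (ii) ∧ (iii)-saturation ∧ (`N`-th roots) at the GENUINE connected base AT THE ROOTS READING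
of the `(N, H_⊙^{bs-fld})`-saturation slot ⇐ {`Remark372 D₀ / D₀'` (Rmk 3.7.2), `hBmon₁ / hBmon₂`} ONLY** (the reading
is WEAKER than print's cohomological [FrdII] Def 2.2 (ii)(c); at the faithful reading T44-L15b stays an input):
abc-iut-w5-d179's `thm44_mkOfConnectedTemperoid` with its last binder T44-L15b supplied by
`preservesNHSaturatedBsFld_rootsReading`. [cite: MochizukiEtTh2009, Thm 4.4 p.94] -/
theorem Thm44Hyp.thm44_mkOfConnectedTemperoid_rootsReading
    (h : Thm44Hyp
      (mkOfConnectedTemperoid X₁ tf₁ hZ₁ hP₁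
        (fun _ A M => ∀ (g : A.base ⟶ A₁.base) (x : tf₁.ratFnFunctor.obj (op A₁.base)),
          divB tf₁.divisorMonoid tf₁.ratFnFunctor tf₁.divBNatTrans (op A₁.base) x = 1 →
            ∃ ζ : tf₁.ratFnFunctor.obj (op A.base), ζ ^ (M : ℕ) = pull tf₁.ratFnFunctor g x)
        A₁ hA₁ hA₁')
      (mkOfConnectedTemperoid X₂ tf₂ hZ₂ hP₂
        (fun _ A M => ∀ (g : A.base ⟶ A₂.base) (x : tf₂.ratFnFunctor.obj (op A₂.base)),
          divB tf₂.divisorMonoid tf₂.ratFnFunctor tf₂.divBNatTrans (op A₂.base) x = 1 →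
            ∃ ζ : tf₂.ratFnFunctor.obj (op A.base), ζ ^ (M : ℕ) = pull tf₂.ratFnFunctor g x)
        A₂ hA₂ hA₂'))
    (h372 : TemperedFrobenioid.Remark372 D₀) (h372' : TemperedFrobenioid.Remark372 D₀')
    (hBmon₁ : IsMonoidOn tf₁.ratFnFunctor) (hBmon₂ : IsMonoidOn tf₂.ratFnFunctor) :
    Thm44_i h ∧
      Thm44_ii h (h.psiModel (tf₁.isFrobenioid_treeCatVocab_of_isMonoidOn hBmon₁)
        (tf₂.isFrobenioid_treeCatVocab_of_isMonoidOn hBmon₂)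
        (h.preservesFrobeniusStructure_treeVocab h372 h372' hBmon₁ hBmon₂)) ∧
      Thm44_iii h (h.psiModel (tf₁.isFrobenioid_treeCatVocab_of_isMonoidOn hBmon₁)
        (tf₂.isFrobenioid_treeCatVocab_of_isMonoidOn hBmon₂)
        (h.preservesFrobeniusStructure_treeVocab h372 h372' hBmon₁ hBmon₂)) ∧
      h.PreservesNthRoots (h.psiModel (tf₁.isFrobenioid_treeCatVocab_of_isMonoidOn hBmon₁)
        (tf₂.isFrobenioid_treeCatVocab_of_isMonoidOn hBmon₂)
        (h.preservesFrobeniusStructure_treeVocab h372 h372' hBmon₁ hBmon₂))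
        (fun φ f => tf₁.pullFracModel φ f) (fun φ f => tf₂.pullFracModel φ f) :=
  h.thm44_mkOfConnectedTemperoid h372 h372' hBmon₁ hBmon₂
    (Thm44Hyp.preservesNHSaturatedBsFld_rootsReading tf₁ hZ₁ hP₁ _ _ _ A₁ hA₁ hA₁' tf₂ hZ₂ hP₂ _ _ _ A₂ hA₂ hA₂' h
      (tf₁.isFrobenioid_treeCatVocab_of_isMonoidOn hBmon₁) (tf₂.isFrobenioid_treeCatVocab_of_isMonoidOn hBmon₂)
      (h.preservesFrobeniusStructure_treeVocab h372 h372' hBmon₁ hBmon₂))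

end Connected

end BiKummerSetting

end Literature.AnabelianGeometry.EtaleTheta

end
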